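import Summits.BirchSwinnertonDyer.BirchSwinnertonDyer.Theses.TameQuarticSolvent
import Summits.BirchSwinnertonDyer.BirchSwinnertonDyer.Theorems.TameQuarticSolventSolventPairLowerBoundPairGivenGoodFieldOf
import Summits.BirchSwinnertonDyer.BirchSwinnertonDyer.Theorems.TameQuarticSolventSolventPairLowerBoundTwistDatumOfFriedbergHoffstein
import Summits.BirchSwinnertonDyer.BirchSwinnertonDyer.Theorems.TameQuarticSolventSolventPairLowerBoundStubGoodReduction
import HarnessLib

/-!
# Route `TameQuarticSolvent`, crux `SolventPairLowerBound` (stmt-BirchSwinnertonDyer-21391), line `birth` —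
# ONE-SIDED refinement: the crux needs only the LOWER half of `BSD₃(E_M/M)` over the tame quartic (K1⁻), not
# exact `BSD₃` (K1)

HONEST FRAMING. Theorems only; helper file (`--supports stmt-BirchSwinnertonDyer-21391`). The line `birth` has
reduced the crux to «six published inputs ∧ K1 ∧ K2a» (skeleton v4; `stub_pairGivenGoodField_of`, lead's
`solventPairLowerBound_of_published_of_K1_of_K2a`), with K1 = EXACT `BSD₃` of `E` over the totally real tame
quartic `M`. This file records — kernel-checked — that the squeeze uses only ONE HALF of K1: by the valuation
identity `δ₃(E/M) = δ₃(E) + δ₃(E^{(d_K)}) + δ₃(E′)` (`δ₃(X) = ord₃ #Ш_an(X) − ord₃ #Ш(X)[3^∞]`; tree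
`padicValRat_analyticSha_quadraticTower`, which also yields `Ш(E/M)[3^∞]` finite and `#Ш_an(E/M) ∈ ℚ` FOR FREE from
the constituents), the UPPER bound `δ₃(E′) ≥ 0` (K2a) and the LOWER bound `δ₃(E/M) ≤ 0` give
`δ₃(E) + δ₃(E^{(d_K)}) ≤ 0`, i.e. the stub. So the open input to promote is
**K1⁻ («LowerBSD3OverSolventQuartic»)**: for `W` on the leaf and `K ⊂ M` as in K1 (totally real quartic,
`e(w|3) = 4`, good reduction above `3`), IF `Ш(E_M/M)[3^∞]` is finite THEN every rational value `qM` of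
`#Ш_an(E_M/M)` satisfies `ord₃ qM ≤ ord₃ #Ш(E_M/M)[3^∞]` — the «main-conjecture ⊇ / Eisenstein» direction of
signed Iwasawa theory over `M`, exactly the route thesis' one-sided design («no lower bound is ever asked of an
auxiliary object» — and, by this file, no UPPER bound of the main one). K1 ⇒ K1⁻ (`lowerBound_of_bsdpOver`).
Nothing here is progress on K1⁻/K2a themselves; BSD is not proved by any of this. The route file is imported only
to conclude the crux decl BY NAME in the conditional theorem `solventPairLowerBound_of_published_of_K1low_of_K2a`
(CONDITIONAL on eight hypotheses; credits nothing toward closing the item).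

References: T. Dokchitser, V. Dokchitser, Ann. of Math. 172 (2010) Thm. 2.3; J. S. Milne, Invent. Math. 17 (1972)
Thm. 1; R. L. Miller, LMS J. Comput. Math. 14 (2011) §1; B. Gross, D. Zagier, Invent. Math. 84 (1986) Thm. I.(7.3);
S. Friedberg, J. Hoffstein, Ann. of Math. 142 (1995) Thm. B.
-/

-- D-0017: single-problem summit, so `Summit.BirchSwinnertonDyer.BirchSwinnertonDyer.…` repeats a namespace BY DESIGN.
set_option linter.dupNamespace false

noncomputable section

open scoped NumberField

open IsDedekindDomain IsDedekindDomain.HeightOneSpectrum NumberField WithZero WeierstrassCurve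
  Literature.NumberTheory.EllipticCurves Literature.NumberTheory.EllipticCurves.ModularForms
  Literature.NumberTheory.EllipticCurves.Rank1Residual Summit.BirchSwinnertonDyer.Rank1Residual.Additive

namespace Summit.BirchSwinnertonDyer.BirchSwinnertonDyer.Theorems.SolventPairLowerBound

/-! ## K1 ⇒ K1⁻ -/

/-- **K1 implies K1⁻** (exact `BSD₃(E_M/M)` gives in particular the lower bound, the rational value of
`#Ш_an` being unique). Bookkeeping. [cite: Miller2011LMS, Def. 1.1 (arXiv:1010.2431 p. 3)] -/
theorem lowerBound_of_bsdpOver {M : Type} [Field M] [NumberField M] (V : WeierstrassCurve M)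
    (h : BSDpOver V 3) (qM : ℚ) (hqM : analyticSha V = (qM : ℂ)) :
    padicValRat 3 qM ≤ padicValNat 3 (Nat.card (AddCommGroup.primaryComponent V.sha 3)) := by
  obtain ⟨-, q, hq, hv⟩ := h
  have hqq : q = qM := by exact_mod_cast hq.symm.trans hqM
  subst hqq
  exact hv.le

/-! ## The stub from K1⁻ and K2a -/

/-- **`stub_pairGivenGoodField` from the LOWER-bound half over `M` (K1⁻), K2a and published inputs.** GIVEN the
named facts Dokchitser–Dokchitser 2010 Thm. 2.3 (`p`-part, Milne's form: `hDD`), modularity (`hmod`, `hmodP`),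
Gross–Zagier Thm. I.(7.3) (`hGZ`), Gross–Zagier–Kolyvagin (`hGZK`), the OPEN lower bound K1⁻ over every totally
real quartic `M = K(√β) ⊃ K` (`[K:ℚ] = [M:K] = 2`, `e(w|3) = 4`, good reduction above `3`) — «if `Ш(E_M/M)[3^∞]` is
finite then `ord₃ #Ш_an(E_M/M) ≤ ord₃ #Ш(E_M/M)[3^∞]`» — and K2a (over `K = ℚ(√d)`: a totally positive `β` of odd
valuation above `3` with a `K`-model of `E_K^{(β)}` having entire `L`-function, finite `Ш[3^∞]`, rational `#Ш_an` and
the Kolyvagin UPPER bound), the body of the registered stub `stub_pairGivenGoodField` holds. Proof: as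
`stub_pairGivenGoodField_of`, with the exact `BSDpOver` replaced by the valuation identity
`padicValRat_analyticSha_quadraticTower` and `linarith`.
[cite: DokchitserDokchitserAnnals2010, §2.1 Thm. 2.3 (second clause) and its proof]
[cite: Miller2011LMS, §1 and Def. 1.1 (arXiv:1010.2431 p. 3)] -/
theorem stub_pairGivenGoodField_of_lower
    (hDD : Milne1972.bsdQuotientP_baseChange_relQuadratic_anyModel)
    (hmod : exists_isNewformOf) (hmodP : nonempty_modularParametrizationData)
    (hGZ : GrossZagier1986_thm_I_7_3) (hGZK : rank_eq_analyticRank_of_analyticRank_le_one)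
    (K1low : ∀ (W : WeierstrassCurve ℚ) [W.IsElliptic] [W.IsGloballyMinimal],
      ¬ W.HasCM → Addv W 3 → Summit.BirchSwinnertonDyer.Rank1Residual.Additive.SubTprime W 3 →
      W.analyticRank = 1 →
      ∀ (K : Type) [Field K] [NumberField K] (M : Type) [Field M] [NumberField M] [Algebra K M],
        Module.finrank ℚ K = 2 → Module.finrank K M = 2 → IsTotallyReal M →
        (∀ w : HeightOneSpectrum (𝓞 M), ((3 : ℕ) : 𝓞 M) ∈ w.asIdeal →
          w.asIdeal.ramificationIdx ℤ = 4) →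
        (∀ w : HeightOneSpectrum (𝓞 M), ((3 : ℕ) : 𝓞 M) ∈ w.asIdeal →
          (W.baseChange M).HasGoodReductionAt w) →
        Finite (AddCommGroup.primaryComponent (W.baseChange M).sha 3) →
        ∀ qM : ℚ, analyticSha (W.baseChange M) = (qM : ℂ) →
          padicValRat 3 qM ≤
            padicValNat 3 (Nat.card (AddCommGroup.primaryComponent (W.baseChange M).sha 3)))
    (K2a : ∀ (W : WeierstrassCurve ℚ) [W.IsElliptic] [W.IsGloballyMinimal],
      ¬ W.HasCM → Addv W 3 → Summit.BirchSwinnertonDyer.Rank1Residual.Additive.SubTprime W 3 →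
      W.analyticRank = 1 →
      ∀ (d : ℤ), 0 < d → padicValInt 3 d = 1 →
      ∀ (K : Type) [Field K] [NumberField K] (θ₁ : K), Module.finrank ℚ K = 2 → θ₁ ^ 2 = (d : K) →
        ∃ β : K,
          (∀ v : HeightOneSpectrum (𝓞 K), ((3 : ℕ) : 𝓞 K) ∈ v.asIdeal →
            ∃ k : ℤ, v.valuation K β = WithZero.exp (2 * k + 1)) ∧
          (∀ σ : K →+* ℝ, 0 < σ β) ∧
          ∃ (Vβ : WeierstrassCurve K) (_ : Vβ.IsElliptic),
            (∃ C : WeierstrassCurve.VariableChange K, C • (W.baseChange K).quadraticTwist β = Vβ) ∧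
            Vβ.HasEntireLFunction ∧
            Finite (AddCommGroup.primaryComponent Vβ.sha 3) ∧
            ∃ qβ : ℚ, analyticSha Vβ = (qβ : ℂ) ∧
              (padicValNat 3 (Nat.card (AddCommGroup.primaryComponent Vβ.sha 3)) : ℤ) ≤
                padicValRat 3 qβ) :
    ∀ (W : WeierstrassCurve ℚ) [W.IsElliptic] [W.IsGloballyMinimal],
    ¬ W.HasCM → Addv W 3 → Summit.BirchSwinnertonDyer.Rank1Residual.Additive.SubTprime W 3 →
      W.analyticRank = 1 →
    (∀ (L : Type) [Field L] [NumberField L] (v : HeightOneSpectrum (𝓞 L)),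
      ((3 : ℕ) : 𝓞 L) ∈ v.asIdeal → v.asIdeal.ramificationIdx ℤ = 4 →
      (W.baseChange L).HasGoodReductionAt v) →
    ∀ (d : ℤ) (Wd : WeierstrassCurve ℚ) [Wd.IsElliptic] [Wd.IsGloballyMinimal],
      0 < d → padicValInt 3 d = 1 →
      (∃ C : WeierstrassCurve.VariableChange ℚ, C • W.quadraticTwist (d : ℚ) = Wd) →
      ¬ Wd.HasCM → Addv Wd 3 → Summit.BirchSwinnertonDyer.Rank1Residual.Additive.SubTprime Wd 3 →
      Wd.analyticRank = 0 →
      ∃ q q' : ℚ, shaAn W = (q : ℂ) ∧ shaAn Wd = (q' : ℂ) ∧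
        padicValRat 3 q + padicValRat 3 q' ≤
          (padicValNat 3 W.shaOrder : ℤ) + (padicValNat 3 Wd.shaOrder : ℤ) := by
  intro W _ _ hCM hadd hsub hr hgood d Wd _ _ hd0 hd hWd _hCMd _haddd _hsubd hr0
  -- published inputs over `ℚ`
  have hE : hasEntireLFunction_rat := WeierstrassCurve.hasEntireLFunction_rat_of_exists_isNewformOf hmod
  have hAM : ArtinMilneShaDecomposition := artinMilneShaDecomposition_of_relQuadratic hDD
  obtain ⟨qW, hqW⟩ := Disegni2020.exists_rat_shaAn_eq_of_analyticRank_eq_one hGZ hGZK W hr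
  obtain ⟨qWd, hqWd⟩ := exists_rat_shaAn_eq_of_analyticRank_eq_zero hmodP hGZK Wd hr0
  haveI : Finite W.sha := (hGZK W (by omega)).2
  haveI : Finite Wd.sha := (hGZK Wd (by omega)).2
  -- the real quadratic field `K = ℚ(√d)`
  obtain ⟨K, _, _, θ₁, h2, hθ₁, hθK⟩ :=
    exists_quadraticField_sq_eq_intCast (not_isSquare_ratCast_of_padicValInt_eq_one 3 hd)
  have hWd' := exists_variableChange_quadraticTwist_discr h2 hθ₁ hθK W Wd hWd
  -- K2a: the element `β` and the twisted model over `K`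
  obtain ⟨β, hval, hpos, Vβ, _, hVβ, hVβL, hβfin, qβ, hqβ, hβup⟩ :=
    K2a W hCM hadd hsub hr d hd0 hd K θ₁ h2 hθ₁
  obtain ⟨v₀, hv₀⟩ := exists_heightOneSpectrum_natCast_mem K 3
  obtain ⟨k₀, hk₀⟩ := hval v₀ hv₀
  obtain ⟨M, _, _, _, θ, h2', hθ, hθM⟩ := exists_relQuadratic_sq_eq (not_isSquare_of_valuation_eq_exp v₀ hk₀)
  -- properties of `M`
  have he : ∀ w : HeightOneSpectrum (𝓞 M), ((3 : ℕ) : 𝓞 M) ∈ w.asIdeal →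
      w.asIdeal.ramificationIdx ℤ = 4 := fun w hw ↦ by
    have h := ramificationIdx_int_eq_of_sq_eq (K := K) (M := M) 3 h2' hθ (e₀ := 2)
      (fun v hv ↦ ⟨(ramificationIdx_eq_two_of_sq_eq_intCast 3 h2 hθ₁ hd v hv).1, hval v hv⟩) w hw
    simpa using h
  have hgoodM : ∀ w : HeightOneSpectrum (𝓞 M), ((3 : ℕ) : 𝓞 M) ∈ w.asIdeal →
      (W.baseChange M).HasGoodReductionAt w := fun w hw ↦ hgood M w hw (he w hw)
  have hTR : IsTotallyReal M :=
    isTotallyReal_of_sq_eq_of_totallyPositive h2 hd0.le hθ₁ hθK h2' hθ hθM hpos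
  -- the valuation identity over `ℚ ⊂ K ⊂ M`
  haveI : (W.baseChange M).IsElliptic := by
    rw [WeierstrassCurve.baseChange]; infer_instance
  have hVM : ∃ C : WeierstrassCurve.VariableChange M, C • W.baseChange M = W.baseChange M :=
    ⟨1, one_smul _ _⟩
  obtain ⟨hfVM, qM, hqM, -, -, -, -, hδ⟩ :=
    padicValRat_analyticSha_quadraticTower hAM W K h2 Wd hWd' M h2' hθ hθM Vβ hVβ (W.baseChange M) hVM 3
      inferInstance inferInstance hβfin (hE W) (hE Wd) hVβL hqW hqWd hqβ
  -- K1⁻: the lower bound over `M`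
  have hlow := K1low W hCM hadd hsub hr K M h2 h2' hTR he hgoodM hfVM qM hqM
  refine ⟨qW, qWd, hqW, hqWd, ?_⟩
  have h : padicValRat 3 qW + padicValRat 3 qWd ≤
      (padicValNat 3 (Nat.card (AddCommGroup.primaryComponent W.sha 3)) : ℤ) +
        (padicValNat 3 (Nat.card (AddCommGroup.primaryComponent Wd.sha 3)) : ℤ) := by
    linarith
  rwa [padicValNat_card_addPrimaryComponent (A := W.sha) 3,
    padicValNat_card_addPrimaryComponent (A := Wd.sha) 3] at h

/-! ## The crux by name from six published inputs, K1⁻ and K2a (CONDITIONAL) -/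

/-- **Crux `SolventPairLowerBound` from six published inputs, K1⁻ and K2a** — the birth skeleton's composition
(`stub_twistDatum_of_friedbergHoffstein` → `stub_goodReduction` → `stub_pairGivenGoodField_of_lower`) with the LOWER
half K1⁻ in place of exact `BSD₃` (K1). CONDITIONAL on all eight hypotheses; credits nothing toward closing the
item; displays that the open content of 21391 is «K1⁻ ∧ K2a modulo print».
[cite: DokchitserDokchitserAnnals2010, §2.1 Thm. 2.3] [cite: FriedbergHoffstein1995, Thm. B (1)]
[cite: GrossZagier1986, Thm. I.(7.3)] [cite: Milne1972ArithmeticAV, §1 Thm. 1] -/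
theorem solventPairLowerBound_of_published_of_K1low_of_K2a
    (hmod : exists_isNewformOf) (hmodP : nonempty_modularParametrizationData)
    (hGZ : GrossZagier1986_thm_I_7_3) (hGZK : rank_eq_analyticRank_of_analyticRank_le_one)
    (hDD : Milne1972.bsdQuotientP_baseChange_relQuadratic_anyModel)
    (hFH : friedbergHoffstein_exists_pos_twist_ne_zero_ramifiedAtThree)
    (K1low : ∀ (W : WeierstrassCurve ℚ) [W.IsElliptic] [W.IsGloballyMinimal],
      ¬ W.HasCM → Addv W 3 → Summit.BirchSwinnertonDyer.Rank1Residual.Additive.SubTprime W 3 →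
      W.analyticRank = 1 →
      ∀ (K : Type) [Field K] [NumberField K] (M : Type) [Field M] [NumberField M] [Algebra K M],
        Module.finrank ℚ K = 2 → Module.finrank K M = 2 → IsTotallyReal M →
        (∀ w : HeightOneSpectrum (𝓞 M), ((3 : ℕ) : 𝓞 M) ∈ w.asIdeal →
          w.asIdeal.ramificationIdx ℤ = 4) →
        (∀ w : HeightOneSpectrum (𝓞 M), ((3 : ℕ) : 𝓞 M) ∈ w.asIdeal →
          (W.baseChange M).HasGoodReductionAt w) →
        Finite (AddCommGroup.primaryComponent (W.baseChange M).sha 3) →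
        ∀ qM : ℚ, analyticSha (W.baseChange M) = (qM : ℂ) →
          padicValRat 3 qM ≤
            padicValNat 3 (Nat.card (AddCommGroup.primaryComponent (W.baseChange M).sha 3)))
    (K2a : ∀ (W : WeierstrassCurve ℚ) [W.IsElliptic] [W.IsGloballyMinimal],
      ¬ W.HasCM → Addv W 3 → Summit.BirchSwinnertonDyer.Rank1Residual.Additive.SubTprime W 3 →
      W.analyticRank = 1 →
      ∀ (d : ℤ), 0 < d → padicValInt 3 d = 1 →
      ∀ (K : Type) [Field K] [NumberField K] (θ₁ : K), Module.finrank ℚ K = 2 → θ₁ ^ 2 = (d : K) →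
        ∃ β : K,
          (∀ v : HeightOneSpectrum (𝓞 K), ((3 : ℕ) : 𝓞 K) ∈ v.asIdeal →
            ∃ k : ℤ, v.valuation K β = WithZero.exp (2 * k + 1)) ∧
          (∀ σ : K →+* ℝ, 0 < σ β) ∧
          ∃ (Vβ : WeierstrassCurve K) (_ : Vβ.IsElliptic),
            (∃ C : WeierstrassCurve.VariableChange K, C • (W.baseChange K).quadraticTwist β = Vβ) ∧
            Vβ.HasEntireLFunction ∧
            Finite (AddCommGroup.primaryComponent Vβ.sha 3) ∧
            ∃ qβ : ℚ, analyticSha Vβ = (qβ : ℂ) ∧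
              (padicValNat 3 (Nat.card (AddCommGroup.primaryComponent Vβ.sha 3)) : ℤ) ≤
                padicValRat 3 qβ) :
    Summit.BirchSwinnertonDyer.BirchSwinnertonDyer.Theses.TameQuarticSolvent.SolventPairLowerBound := by
  intro W _ _ hCM hadd hsub hr
  obtain ⟨d, Wd, i1, i2, hd, hv, htw, hCMd, haddd, hsubd, hr0⟩ :=
    stub_twistDatum_of_friedbergHoffstein hmod hFH W hCM hadd hsub hr
  exact ⟨d, Wd, i1, i2, hd, hv, htw, hCMd, haddd, hsubd, hr0,
    stub_pairGivenGoodField_of_lower hDD hmod hmodP hGZ hGZK K1low K2a W hCM hadd hsub hr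
      (stub_goodReduction W hadd hsub) d Wd hd hv htw hCMd haddd hsubd hr0⟩

end Summit.BirchSwinnertonDyer.BirchSwinnertonDyer.Theorems.SolventPairLowerBound

end
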